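import Summits.CriticalPhenomena.PercolationContinuityZ3.Theorems.PercNearOneGluingNoHeavyLowerTailSahiCTCC2ThreeReduction
import HarnessLib

/-!
# `NoHeavyLowerTail` (crux stmt-CriticalPhenomena-4575), P3 lane: the HIGH ROWS OF `R_3` ARE UNCONDITIONAL —
# `coeff_n R_3 ≥ 0` whenever `n` has an entry `≥ 3` or at least four doubled points, and single points DROP freely at `≥ 3` doubled points

Support file (seat `prim-l12-p3`, gen 44; `--supports stmt-CriticalPhenomena-4575`).  Memo
`run/shared/lean/prim/prim-l12/FROM-prim-l12-p3-g44-R3-PEELS.md` §1, §4.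

g43's `…SahiCTCC2ThreeReduction` proves the level-3 monotonicity C2 of `R_3` at every vertex with an entry `≥ 3` or `≥ 3` further doubled points, and
derives `R_3 ∈ ℕ[s]` CONDITIONALLY on C2 at the low rows.  For the peel induction of gen 44 (memo §4) one needs the UNCONDITIONAL consequences, which
this file records:
* `coeff_Rt_three_nonneg_of_three_le` : an entry `≥ 3` ⇒ `coeff_n R_3 ≥ 0` (top slice = `R_2` of the cylinders, `…C2TopSlice`, and `R_2 ∈ ℕ[s]`);
* `coeff_Rt_three_nonneg_of_four_le_card_dbl` : all entries `≤ 2` and `≥ 4` doubled points ⇒ `coeff_n R_3 ≥ 0` (C2 at a doubled point, then the first);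
* `coeff_Rt_three_drop_of_three_le_card_dbl` : all entries `≤ 2`, `≥ 3` doubled points, `s` a single point ⇒ `coeff_{n−e_s} R_3 ≤ coeff_n R_3`
  (C1 at `s` from C2 at `s`, `…LumpedVertex.coeff_C1_sub_C2_nonneg`): at three or more doubled points every single point can be dropped, so the
  profiles with exactly three doubled points reduce to the 3-point diagonal `coeff_{2·1_D} R_3`, `#D = 3`.
Nothing is asserted about the crux; the low rows (≤ 2 doubled points) are NOT treated here.
-/

noncomputable section

open scoped Classical

namespace Summit.CriticalPhenomena.PercolationContinuityZ3.Theorems.SahiCTCForms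

open Finset MvPolynomial SahiCTCGenFun

variable {α : Type*} [DecidableEq α] [Fintype α]

variable {F G : Finset (Finset α)}

/-- **An entry `≥ 3` makes the coefficient of `R_3` nonnegative**: the top slice at that point is `R_2` of the two cylinders (up-sets), and
`R_2 ∈ ℕ[s]`; entries `≥ 4` give `0`. [this work] -/
theorem coeff_Rt_three_nonneg_of_three_le (hF : IsUpperSet (F : Set (Finset α))) (hG : IsUpperSet (G : Set (Finset α)))
    {n : α →₀ ℕ} {w : α} (hw : 3 ≤ n w) : 0 ≤ (Rt 3 F G).coeff n := by
  by_cases h4 : 4 ≤ n w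
  · rw [coeff_Rt_eq_zero_of_four_le 3 F G h4]
  · have h3 : n w = 3 := by omega
    set m := n - Finsupp.single w 3 with hm
    have hmw : m w = 0 := by rw [hm, Finsupp.tsub_apply, Finsupp.single_eq_same, h3]
    have hn : n = m + Finsupp.single w 3 := by
      rw [hm, tsub_add_cancel_of_le]
      rw [Finsupp.single_le_iff, h3]
    rw [hn, coeff_Rt_succ_add_single_three 2 F G w hmw]
    exact coeff_Rt_two_nonneg (isUpperSet_cyl hF w) (isUpperSet_cyl hG w) m

/-- **Four doubled points make the coefficient of `R_3` nonnegative** (all entries `≤ 2`): C2 at one of them bounds the coefficient below by the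
coefficient with that point tripled, which is `≥ 0`. [this work] -/
theorem coeff_Rt_three_nonneg_of_four_le_card_dbl (hF : IsUpperSet (F : Set (Finset α))) (hG : IsUpperSet (G : Set (Finset α)))
    {n : α →₀ ℕ} (h4 : 4 ≤ #(dbl n)) : 0 ≤ (Rt 3 F G).coeff n := by
  obtain ⟨v, hv⟩ : (dbl n).Nonempty := card_pos.1 (by omega)
  have hv2 : n v = 2 := mem_dbl_iff.1 hv
  have hcard : 3 ≤ #((dbl n).erase v) := by rw [card_erase_of_mem hv]; omega
  have hC2 := coeff_Rt_three_C2_of_not_low hF hG n v hv2 (Or.inr hcard)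
  have h3 : 0 ≤ (Rt 3 F G).coeff (n + Finsupp.single v 1) :=
    coeff_Rt_three_nonneg_of_three_le hF hG (w := v) (by rw [Finsupp.add_apply, Finsupp.single_eq_same, hv2])
  linarith

/-- **Single points drop freely at three or more doubled points**: if all entries of `n` are `≤ 2`, `n` has at least three doubled points and
`n_s = 1`, then `coeff_{n − e_s} R_3 ≤ coeff_n R_3` (C1 at `s`, from C2 at `s` whose base has `≥ 3` doubled points off `s`). [this work] -/
theorem coeff_Rt_three_drop_of_three_le_card_dbl (hF : IsUpperSet (F : Set (Finset α))) (hG : IsUpperSet (G : Set (Finset α)))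
    {n : α →₀ ℕ} {s : α} (hs : n s = 1) (h3 : 3 ≤ #(dbl n)) :
    (Rt 3 F G).coeff (n - Finsupp.single s 1) ≤ (Rt 3 F G).coeff n := by
  set m := n - Finsupp.single s 1 with hm
  have hms : m s = 0 := by rw [hm, Finsupp.tsub_apply, Finsupp.single_eq_same, hs]
  have hn : n = m + Finsupp.single s 1 := by
    rw [hm, tsub_add_cancel_of_le]
    rw [Finsupp.single_le_iff, hs]
  -- the doubled points of `m + 2e_s` off `s` are those of `n`
  have hdbl : (dbl (m + Finsupp.single s 2)).erase s = dbl n := by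
    ext w
    simp only [mem_erase, mem_dbl_iff, Finsupp.add_apply, Finsupp.single_apply]
    by_cases hw : s = w
    · subst hw; simp [hs]
    · simp only [hw, if_false, add_zero]
      rw [hn, Finsupp.add_apply, Finsupp.single_apply, if_neg hw, add_zero]
      exact ⟨fun h => h.2, fun h => ⟨fun h' => hw h'.symm, h⟩⟩
  have hC2 : (Rt 3 F G).coeff (m + Finsupp.single s 2 + Finsupp.single s 1) ≤ (Rt 3 F G).coeff (m + Finsupp.single s 2) :=
    coeff_Rt_three_C2_of_not_low hF hG _ s (by rw [Finsupp.add_apply, Finsupp.single_eq_same, hms]) (Or.inr (by rw [hdbl]; exact h3))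
  rw [add_assoc, ← Finsupp.single_add] at hC2
  have hC1 := coeff_C1_sub_C2_nonneg (isLowerSet_bySize_lt 3) hF hG s hms
  rw [← Rt_eq_Rlump] at hC1
  rw [hn]
  linarith

end Summit.CriticalPhenomena.PercolationContinuityZ3.Theorems.SahiCTCForms
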